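import Summits.HodgeConjecture.Statement
import Literature.AlgebraicGeometry.Motives.AbelianVariety
import HarnessLib

/-!
# `AbelianComplement` from its two pieces — route-file-free form (usable as `--glue-by`)

Route `SevenfoldWeilCensus` / `RankFourFaces` of `HodgeConjecture`, item stmt-HodgeConjecture-15889
(`AbelianComplement`). This helper states the bridge assembly of
`Theorems/SevenfoldWeilCensusAbelianComplementBridgeSplit.lean` over the item TEXTS only, importing no route
file, so that a route file may cite it as the glue of the split
`AbelianComplement ⟸ HodgeAbelianVarieties ∧ AbelianToHodge` without an import cycle:

* piece 1 (text of item stmt-HodgeConjecture-1333): the Hodge conjecture for every complex abelian variety;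
* piece 2 (text of item stmt-HodgeConjecture-10452): the Hodge conjecture granted the abelian case;
* conclusion (text of item stmt-HodgeConjecture-15889): the Hodge conjecture off the abelian locus.

Pure logic (modus ponens and restriction); standard axioms; no `sorry`.

References: P. Deligne, *The Hodge conjecture* (Clay, 2000), §1.
-/

-- Summit.HodgeConjecture.HodgeConjecture.… repeats the summit name by the D-0017 layout (Sub = Summit).
set_option linter.dupNamespace false

namespace Summit.HodgeConjecture.HodgeConjecture.Theorems.AbelianComplement.Pieces

open Literature.AlgebraicGeometry.Motives Literature.AlgebraicGeometry.HodgeTheory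

/-- **piece 1 → piece 2 → AbelianComplement**, stated over the item texts (definitionally the route decls
`HodgeAbelianVarieties → AbelianToHodge → AbelianComplement` of the split). [cite: Deligne2000, §1] -/
theorem abelianComplement_of_pieces
    (h₁ : ∀ A : AbelianVariety ℂ, HodgeConjectureFor A.dim A.X)
    (h₂ : (∀ A : AbelianVariety ℂ, IsSmoothProjective A.dim A.X → HodgeConjectureFor A.dim A.X) →
      _root_.HodgeConjecture) :
    ∀ ⦃n : ℕ⦄ ⦃X : SchemeOver ℂ⦄, IsSmoothProjective n X →
      (∀ A : AbelianVariety ℂ, A.dim = n → A.X ≠ X) → HodgeConjectureFor n X :=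
  fun _ _ hX _ ↦ h₂ (fun A _ ↦ h₁ A) hX

/-- The summit-level seam over the item texts: piece 1 → piece 2 → `HodgeConjecture`. [cite: Deligne2000, §1] -/
theorem hodgeConjecture_of_pieces
    (h₁ : ∀ A : AbelianVariety ℂ, HodgeConjectureFor A.dim A.X)
    (h₂ : (∀ A : AbelianVariety ℂ, IsSmoothProjective A.dim A.X → HodgeConjectureFor A.dim A.X) →
      _root_.HodgeConjecture) :
    _root_.HodgeConjecture :=
  h₂ fun A _ ↦ h₁ A

end Summit.HodgeConjecture.HodgeConjecture.Theorems.AbelianComplement.Pieces
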